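import Literature.Probability.RandomPlanarGeometry.BlobTime
import Literature.Probability.RandomPlanarGeometry.BDGS2012Proofs
import Literature.Barriers.CriticalPhenomena.WeaklySAWFourDimLogCorrectionsProofs
import Mathlib.Analysis.SpecialFunctions.Pow.Real
import Mathlib.Analysis.Subadditive
import HarnessLib

/-!
# The blob-time-penalised walk on `ℤ²`: partition sums, connective constant, critical fugacity

Topic `Literature/Probability/RandomPlanarGeometry` (definition item
`defn-BlobTime.connectiveConstant` for route SAWCutPointCondensation of the SAW summit; next to
`BlobTime.lean` — cut times, cut count `cutCount`, blob time `blobTime = length − cutCount` of a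
walk — and to the self-avoiding-walk
thermodynamics of `BDGS2012.lean` / `SAWCount.lean`, whose objects `SAW.Zd.count`,
`SAW.Zd.connectiveConstant`, `SAW.criticalFugacity` are the case `t = 0` of the ones below).

## The model (the route's object; template: BDGS2012 §1.2–1.3)

For a BLOB FUGACITY `t ∈ ℝ` (intended `t ∈ [0,1]`, `t = e^{−λ}`) every `n`-step nearest-neighbour
walk `ω` on `ℤ²` from `0` gets the weight `t^{B(ω)}`, `B` the blob time (`B = 0` iff `ω` is
self-avoiding).  The whole-plane partition sums, connective constant and critical fugacity are
the literal analogues of BDGS2012 (1.7), (1.12) and §1.4 (`z_c = 1/μ`) for the weakly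
self-avoiding walk (which penalises self-INTERSECTIONS `λ`; here the reward goes to CUT TIMES):
* `partitionSum t n = b_n(t) := Σ_{v ∈ box 2 n} Σ_{ω ∈ 𝒲ₙ(0,v)} t^{B(ω)}` — so `b_n(1) = 4ⁿ`
  (all walks, `partitionSum_one`) and `b_n(0) = cₙ` (self-avoiding walks, `partitionSum_zero`);
  for `t = e^{−λ}`, `b_n(t) = 4ⁿ tⁿ · E_SRW[e^{λ Cₙ}]`, `Cₙ = #`cut times (Lawler 1996, §1);
* `connectiveConstant t = μ_B(t) := infₙ≥₁ b_n(t)^{1/n}` (an infimum, as `μ` is in the tree; the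
  limit form needs submultiplicativity `b_{n+m} ≤ b_n b_m` — route item `BlobCountSubmult` — and is
  `tendsto_partitionSum_rpow` under that hypothesis, by Fekete = Mathlib `Subadditive.tendsto_lim`);
* `criticalFugacity t = y_c(t) := μ_B(t)⁻¹` (`y_c(1) = 1/4`, `y_c(0) = x_c = 1/μ`);
* `freeEnergy t := log (μ_B(t) / (4t))`, the cut-time free energy `p(λ) = lim n⁻¹ log E[e^{λCₙ}]`
  at `t = e^{−λ}` (the quantity of crux `FreeEnergyScaling`).

## API (all proved)

`partitionSum_eq`, `connectiveConstant_eq`, `criticalFugacity_eq`, `freeEnergy_eq` (`rfl`: the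
definitions ARE the sub-terms inlined in the route's items, elaborated as there);
`partitionSum_nonneg`, `partitionSum_one` (`= 4ⁿ`, via the walk count
`sum_card_finsetWalkLength_box : Σ_v #𝒲ₙ(0,v) = 4ⁿ`, the case `d = 2` of the tree's
`CTWSAW.sum_card_finsetWalkLength_zdGraph`), `partitionSum_zero` (`= cₙ`),
`pow_mul_le_partitionSum` / `partitionSum_le` (`(4t)ⁿ ≤ b_n(t) ≤ 4ⁿ` on `[0,1]`),
`partitionSum_pos`, `partitionSum_mono` (in `t ≥ 0`); `connectiveConstant_zero`
(`μ_B(0) = μ = SAW.connectiveConstant`), `criticalFugacity_zero` (`= SAW.criticalFugacity`),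
`connectiveConstant_nonneg`, `connectiveConstant_le_rpow` (`μ_B ≤ b_n^{1/n}`),
`pow_connectiveConstant_le_partitionSum` (`μ_Bⁿ ≤ b_n`), `four_mul_le_connectiveConstant` /
`connectiveConstant_le_four` (`4t ≤ μ_B(t) ≤ 4` on `[0,1]`), `connectiveConstant_mono`,
`tendsto_partitionSum_rpow` (Fekete, conditional on submultiplicativity).

Sources: R. Bauerschmidt, H. Duminil-Copin, J. Goodman, G. Slade, *Lectures on self-avoiding
walks* (2012), §1.2–1.3, eqs. (1.7), (1.10), (1.12) (template); G. F. Lawler, *Cut times for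
simple random walk*, EJP 1 (1996), §1 (cut times); N. Madras, G. Slade, *The Self-Avoiding Walk*
(1993), §1.2 (Fekete).  The interpolation itself is the route's object and carries `[folklore]`
tags (nothing is claimed about it beyond what is proved here).
-/

noncomputable section

open Filter Topology Finset SimpleGraph Literature.Probability.LatticeModels
open scoped BigOperators

namespace Literature.Probability.RandomPlanarGeometry.BlobTime

/-! ### Definitions -/

/-- **`b_n(t)`, the blob-time partition sum**: `Σ_{v ∈ box 2 n} Σ_{ω ∈ 𝒲ₙ(0, v)} t^{B(ω)}` over all
`n`-step nearest-neighbour walks on `ℤ²` from the origin (their endpoints lie in the box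
`{-n,…,n}²`), `B = blobTime`.  The blob-fugacity analogue of BDGS2012 (1.7); `b_n(1) = 4ⁿ`,
`b_n(0) = cₙ`. [folklore] -/
def partitionSum (t : ℝ) (n : ℕ) : ℝ :=
  ∑ v ∈ box 2 n, ∑ q ∈ (zdGraph 2).finsetWalkLength n (0 : Site 2) v, t ^ blobTime q

/-- **`μ_B(t)`, the connective constant of the blob-time-penalised walk**: `infₙ≥₁ b_n(t)^{1/n}`
(an infimum, as `SAW.Zd.connectiveConstant`; equal to `lim b_n^{1/n}` once `b` is
submultiplicative, `tendsto_partitionSum_rpow`).  The analogue of BDGS2012 (1.12). [folklore] -/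
def connectiveConstant (t : ℝ) : ℝ :=
  ⨅ n : ℕ, (partitionSum t (n + 1)) ^ (1 / ((n : ℝ) + 1))

/-- **`y_c(t) := μ_B(t)⁻¹`, the critical fugacity** of the blob-time-penalised walk (`y_c(1) = 1/4`:
simple random walk; `y_c(0) = x_c = 1/μ`: self-avoiding walk).  The analogue of BDGS2012 §1.4
(`z_c = 1/μ`). [folklore] -/
def criticalFugacity (t : ℝ) : ℝ :=
  (connectiveConstant t)⁻¹

/-- **The cut-time free energy** `log (μ_B(t) / (4t))` — at `t = e^{−λ}` this is
`p(λ) = limₙ n⁻¹ log E_SRW[e^{λ Cₙ}]` (`Cₙ` = number of cut times of the `n`-step simple random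
walk, Lawler 1996 §1), since `b_n(t) = (4t)ⁿ E_SRW[e^{λ Cₙ}]`; the quantity of crux
`FreeEnergyScaling` of route SAWCutPointCondensation.  Junk (`Real.log` of a non-positive number)
for `t ≤ 0`. [folklore] -/
def freeEnergy (t : ℝ) : ℝ :=
  Real.log (connectiveConstant t / (4 * t))

/-! ### The definitions are the route's inlined terms -/

open scoped Classical in
/-- `partitionSum` is literally the sub-term inlined in the items of route SAWCutPointCondensation
(elaborated, as there, under `open scoped Classical`; `blobTime_eq`). [folklore] -/
theorem partitionSum_eq (t : ℝ) (n : ℕ) :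
    partitionSum t n = ∑ v ∈ box 2 n, ∑ q ∈ (zdGraph 2).finsetWalkLength n (0 : Site 2) v,
      t ^ (q.length - ((Finset.range q.length).filter fun j =>
        ∀ i ∈ Finset.range (j + 1), ∀ k ∈ Finset.Ioc j q.length, q.getVert i ≠ q.getVert k).card) :=
  rfl

open scoped Classical in
/-- `connectiveConstant` is literally the sub-term inlined in the items of route
SAWCutPointCondensation. [folklore] -/
theorem connectiveConstant_eq (t : ℝ) :
    connectiveConstant t = ⨅ n : ℕ, (∑ v ∈ box 2 (n + 1),
      ∑ q ∈ (zdGraph 2).finsetWalkLength (n + 1) (0 : Site 2) v,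
        t ^ (q.length - ((Finset.range q.length).filter fun j =>
          ∀ i ∈ Finset.range (j + 1), ∀ k ∈ Finset.Ioc j q.length,
            q.getVert i ≠ q.getVert k).card)) ^ (1 / ((n : ℝ) + 1)) :=
  rfl

/-- `criticalFugacity t = (connectiveConstant t)⁻¹`. [folklore] -/
theorem criticalFugacity_eq (t : ℝ) : criticalFugacity t = (connectiveConstant t)⁻¹ := rfl

/-- `freeEnergy t = log (connectiveConstant t / (4 t))`. [folklore] -/
theorem freeEnergy_eq (t : ℝ) : freeEnergy t = Real.log (connectiveConstant t / (4 * t)) := rfl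

/-! ### Counting all walks: `Σ_v #𝒲ₙ(0, v) = 4ⁿ` -/

/-- **There are exactly `4ⁿ` nearest-neighbour walks of length `n` from the origin of `ℤ²`** (all
ending in `box 2 n`): the case `d = 2` of
`Literature.Barriers.CriticalPhenomena.CTWSAW.sum_card_finsetWalkLength_zdGraph` (`(2d)ⁿ` walks on
`ℤ^d`, by the first-step recursion and `2d`-regularity). [folklore] -/
theorem sum_card_finsetWalkLength_box (n : ℕ) :
    ∑ v ∈ box 2 n, ((zdGraph 2).finsetWalkLength n (0 : Site 2) v).card = 4 ^ n := by
  simpa using Literature.Barriers.CriticalPhenomena.CTWSAW.sum_card_finsetWalkLength_zdGraph 2 n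

/-! ### Values and bounds of `b_n(t)` -/

/-- `b_n(t) ≥ 0` for `t ≥ 0`. [folklore] -/
theorem partitionSum_nonneg {t : ℝ} (ht : 0 ≤ t) (n : ℕ) : 0 ≤ partitionSum t n :=
  Finset.sum_nonneg fun _ _ => Finset.sum_nonneg fun _ _ => pow_nonneg ht _

/-- **`b_n(1) = 4ⁿ`**: at blob fugacity `1` every walk has weight `1` (simple random walk).
[folklore] -/
theorem partitionSum_one (n : ℕ) : partitionSum 1 n = 4 ^ n := by
  simp only [partitionSum, one_pow, Finset.sum_const, nsmul_eq_mul, mul_one]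
  exact_mod_cast sum_card_finsetWalkLength_box n

/-- `b_0(t) = 1`: the only `0`-step walk is the trivial one, of blob time `0`. [folklore] -/
theorem partitionSum_zero_right (t : ℝ) : partitionSum t 0 = 1 := by
  have h : partitionSum t 0 =
      ∑ v ∈ box 2 0, ∑ _q ∈ (zdGraph 2).finsetWalkLength 0 (0 : Site 2) v, (1 : ℝ) := by
    refine Finset.sum_congr rfl fun v _ => Finset.sum_congr rfl fun q hq => ?_
    have hlen : q.length = 0 := SimpleGraph.mem_finsetWalkLength_iff.1 hq
    have hB : blobTime q = 0 := Nat.eq_zero_of_le_zero (hlen ▸ blobTime_le_length q)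
    rw [hB, pow_zero]
  rw [h]
  simp only [Finset.sum_const, nsmul_eq_mul, mul_one]
  exact_mod_cast sum_card_finsetWalkLength_box 0

/-- **`b_n(0) = cₙ`**: at blob fugacity `0` only the walks of blob time `0`, i.e. the self-avoiding
walks (`blobTime_eq_zero_iff`), survive, each with weight `1`. [folklore] -/
theorem partitionSum_zero (n : ℕ) : partitionSum 0 n = (SAW.count n : ℝ) := by
  classical
  rw [partitionSum, SAW.count, Nat.cast_sum]
  refine Finset.sum_congr rfl fun v _ => ?_
  rw [← Finset.sum_boole]
  refine Finset.sum_congr rfl fun q _ => ?_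
  rw [zero_pow_eq]
  by_cases h : q.IsPath
  · rw [if_pos ((blobTime_eq_zero_iff q).2 h), if_pos h]
  · rw [if_neg (mt (blobTime_eq_zero_iff q).1 h), if_neg h]

/-- `b_n(t) ≤ 4ⁿ` for `t ∈ [0,1]` (`t^B ≤ 1`). [folklore] -/
theorem partitionSum_le {t : ℝ} (ht : t ∈ Set.Icc (0 : ℝ) 1) (n : ℕ) :
    partitionSum t n ≤ 4 ^ n := by
  calc partitionSum t n
      ≤ ∑ v ∈ box 2 n, ∑ _q ∈ (zdGraph 2).finsetWalkLength n (0 : Site 2) v, (1 : ℝ) :=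
        Finset.sum_le_sum fun v _ => Finset.sum_le_sum fun q _ => pow_le_one₀ ht.1 ht.2
    _ = 4 ^ n := by
        simp only [Finset.sum_const, nsmul_eq_mul, mul_one]
        exact_mod_cast sum_card_finsetWalkLength_box n

/-- `(4t)ⁿ ≤ b_n(t)` for `t ∈ [0,1]` (`B(ω) ≤ n`, so `t^{B(ω)} ≥ tⁿ`). [folklore] -/
theorem pow_mul_le_partitionSum {t : ℝ} (ht : t ∈ Set.Icc (0 : ℝ) 1) (n : ℕ) :
    (4 * t) ^ n ≤ partitionSum t n := by
  calc (4 * t) ^ n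
      = ∑ v ∈ box 2 n, ∑ _q ∈ (zdGraph 2).finsetWalkLength n (0 : Site 2) v, t ^ n := by
        simp only [Finset.sum_const, nsmul_eq_mul]
        rw [← Finset.sum_mul, ← Nat.cast_sum, sum_card_finsetWalkLength_box n]
        push_cast
        ring
    _ ≤ partitionSum t n := by
        refine Finset.sum_le_sum fun v _ => Finset.sum_le_sum fun q hq => ?_
        have hlen : q.length = n := (SimpleGraph.mem_finsetWalkLength_iff).1 hq
        exact pow_le_pow_of_le_one ht.1 ht.2 (hlen ▸ blobTime_le_length q)

/-- `b_n(t) > 0` for `t ∈ [0,1]`: for `t > 0` by `(4t)ⁿ ≤ b_n(t)`, for `t = 0` because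
`b_n(0) = cₙ ≥ 1`. [folklore] -/
theorem partitionSum_pos {t : ℝ} (ht : t ∈ Set.Icc (0 : ℝ) 1) (n : ℕ) : 0 < partitionSum t n := by
  rcases ht.1.eq_or_lt with h | h
  · rw [← h, partitionSum_zero]
    exact Nat.cast_pos.2 (SAW.Zd.one_le_count 2 n : 1 ≤ SAW.count n)
  · exact (pow_pos (by linarith) n).trans_le (pow_mul_le_partitionSum ht n)

/-- `b_n` is monotone in the fugacity `t ≥ 0`. [folklore] -/
theorem partitionSum_mono (n : ℕ) : MonotoneOn (fun t => partitionSum t n) (Set.Ici 0) :=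
  fun _ hs _ _ hst => Finset.sum_le_sum fun _ _ => Finset.sum_le_sum fun _ _ =>
    pow_le_pow_left₀ hs hst _

/-! ### The connective constant `μ_B(t)` and the critical fugacity -/

/-- **`μ_B(0) = μ`**: at blob fugacity `0` the connective constant is that of the self-avoiding
walk (`SAW.connectiveConstant`, `= SAW.Zd.connectiveConstant 2`). [folklore] -/
theorem connectiveConstant_zero : connectiveConstant 0 = SAW.connectiveConstant := by
  simp only [connectiveConstant, partitionSum_zero]
  rfl

/-- **`y_c(0) = x_c = 1/μ`**: at blob fugacity `0` the critical fugacity is the SAW critical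
fugacity `SAW.criticalFugacity`. [folklore] -/
theorem criticalFugacity_zero : criticalFugacity 0 = SAW.criticalFugacity := by
  rw [criticalFugacity, connectiveConstant_zero]
  rfl

/-- `μ_B(t) ≥ 0` for `t ≥ 0` (an infimum of non-negative reals). [folklore] -/
theorem connectiveConstant_nonneg {t : ℝ} (ht : 0 ≤ t) : 0 ≤ connectiveConstant t :=
  Real.iInf_nonneg fun n => Real.rpow_nonneg (partitionSum_nonneg ht (n + 1)) _

/-- The family `b_{n+1}(t)^{1/(n+1)}` is bounded below (by `0`) for `t ≥ 0`. [folklore] -/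
theorem bddBelow_range_rpow {t : ℝ} (ht : 0 ≤ t) :
    BddBelow (Set.range fun n : ℕ => (partitionSum t (n + 1)) ^ (1 / ((n : ℝ) + 1))) :=
  ⟨0, by rintro _ ⟨n, rfl⟩; exact Real.rpow_nonneg (partitionSum_nonneg ht (n + 1)) _⟩

/-- `μ_B(t) ≤ b_n(t)^{1/n}` for `n ≥ 1` and `t ≥ 0` (definition as an infimum). [folklore] -/
theorem connectiveConstant_le_rpow {t : ℝ} (ht : 0 ≤ t) {n : ℕ} (hn : n ≠ 0) :
    connectiveConstant t ≤ (partitionSum t n) ^ (1 / (n : ℝ)) := by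
  obtain ⟨k, rfl⟩ := Nat.exists_eq_succ_of_ne_zero hn
  have := ciInf_le (bddBelow_range_rpow ht) k
  simpa [connectiveConstant, Nat.cast_succ] using this

/-- **`μ_B(t)ⁿ ≤ b_n(t)` for all `n`** (`t ≥ 0`), immediate from the definition of `μ_B` as an
infimum (the analogue of the second half of BDGS2012 (1.12)). [folklore] -/
theorem pow_connectiveConstant_le_partitionSum {t : ℝ} (ht : 0 ≤ t) (n : ℕ) :
    connectiveConstant t ^ n ≤ partitionSum t n := by
  rcases Nat.eq_zero_or_pos n with rfl | hn
  · rw [pow_zero, partitionSum_zero_right]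
  have h := connectiveConstant_le_rpow ht hn.ne'
  have hc : (0 : ℝ) ≤ partitionSum t n := partitionSum_nonneg ht n
  calc connectiveConstant t ^ n ≤ ((partitionSum t n) ^ (1 / (n : ℝ))) ^ n :=
        pow_le_pow_left₀ (connectiveConstant_nonneg ht) h n
    _ = partitionSum t n := by rw [one_div, Real.rpow_inv_natCast_pow hc hn.ne']

/-- **`μ_B(t) ≤ 4`** for `t ∈ [0,1]` (from `b_1(t) ≤ 4`). [folklore] -/
theorem connectiveConstant_le_four {t : ℝ} (ht : t ∈ Set.Icc (0 : ℝ) 1) :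
    connectiveConstant t ≤ 4 := by
  have h1 := connectiveConstant_le_rpow ht.1 one_ne_zero
  have h2 : partitionSum t 1 ≤ 4 := by simpa using partitionSum_le ht 1
  simp only [Nat.cast_one, div_one, Real.rpow_one] at h1
  exact h1.trans h2

/-- **`4t ≤ μ_B(t)`** for `t ∈ [0,1]` (from `(4t)ⁿ ≤ b_n(t)` for all `n`). [folklore] -/
theorem four_mul_le_connectiveConstant {t : ℝ} (ht : t ∈ Set.Icc (0 : ℝ) 1) :
    4 * t ≤ connectiveConstant t := by
  have h4t : 0 ≤ 4 * t := by linarith [ht.1]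
  refine le_ciInf fun n => ?_
  have hexp : (0 : ℝ) ≤ 1 / ((n : ℝ) + 1) := by positivity
  calc 4 * t = ((4 * t) ^ (n + 1)) ^ (1 / ((n : ℝ) + 1)) := by
        rw [one_div, ← Nat.cast_succ, Real.pow_rpow_inv_natCast h4t (Nat.succ_ne_zero n)]
    _ ≤ (partitionSum t (n + 1)) ^ (1 / ((n : ℝ) + 1)) :=
        Real.rpow_le_rpow (pow_nonneg h4t _) (pow_mul_le_partitionSum ht (n + 1)) hexp

/-- `μ_B(t) > 0` for `t ∈ (0,1]`. [folklore] -/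
theorem connectiveConstant_pos {t : ℝ} (ht : t ∈ Set.Ioc (0 : ℝ) 1) : 0 < connectiveConstant t :=
  (mul_pos four_pos ht.1).trans_le (four_mul_le_connectiveConstant ⟨ht.1.le, ht.2⟩)

/-- `μ_B` is monotone in the fugacity `t ≥ 0`. [folklore] -/
theorem connectiveConstant_mono : MonotoneOn connectiveConstant (Set.Ici 0) := by
  intro s hs t _ hst
  refine ciInf_mono (bddBelow_range_rpow hs) fun n => ?_
  exact Real.rpow_le_rpow (partitionSum_nonneg hs _) (partitionSum_mono _ hs (hs.trans hst) hst)
    (by positivity)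

/-- **`y_c(t) ∈ [1/4, ∞)`-side bounds: `1/4 ≤ y_c(t)`** for `t ∈ (0,1]` (from `μ_B ≤ 4`).
[folklore] -/
theorem inv_four_le_criticalFugacity {t : ℝ} (ht : t ∈ Set.Ioc (0 : ℝ) 1) :
    (4 : ℝ)⁻¹ ≤ criticalFugacity t := by
  rw [criticalFugacity]
  exact inv_anti₀ (connectiveConstant_pos ht) (connectiveConstant_le_four ⟨ht.1.le, ht.2⟩)

/-! ### Fekete: the limit form of `μ_B`, conditional on submultiplicativity -/

/-- **`b_n(t)^{1/n} → μ_B(t)` under submultiplicativity** `b_{n+m}(t) ≤ b_n(t) b_m(t)` (route item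
`BlobCountSubmult`), for `t ∈ [0,1]`: `log b_n` is then subadditive and Fekete's lemma
(Madras–Slade Lemma 1.2.2 = Mathlib `Subadditive.tendsto_lim`) gives convergence of `n⁻¹ log b_n`
to its infimum, `μ_B` being DEFINED as `inf b_n^{1/n}` (verbatim the argument of
`SAW.Zd.tendsto_count_rpow`). [cite: MadrasSlade1993, §1.2, Lemma 1.2.2 and eq. (1.2.9)] -/
theorem tendsto_partitionSum_rpow {t : ℝ} (ht : t ∈ Set.Icc (0 : ℝ) 1)
    (hsub : ∀ n m : ℕ, partitionSum t (n + m) ≤ partitionSum t n * partitionSum t m) :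
    Tendsto (fun n : ℕ => (partitionSum t n) ^ (1 / (n : ℝ))) atTop
      (𝓝 (connectiveConstant t)) := by
  have hpos : ∀ n, (0 : ℝ) < partitionSum t n := partitionSum_pos ht
  have hu : Subadditive fun n => Real.log (partitionSum t n) := by
    intro m n
    rw [← Real.log_mul (hpos m).ne' (hpos n).ne']
    exact Real.log_le_log (hpos _) (hsub m n)
  have hbdd : BddBelow (Set.range fun n : ℕ => Real.log (partitionSum t n) / n) := by
    refine ⟨Real.log (4 * t) ⊓ 0, ?_⟩
    rintro _ ⟨n, rfl⟩
    rcases Nat.eq_zero_or_pos n with rfl | hn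
    · simp
    · rcases ht.1.eq_or_lt with h0 | h0
      · refine inf_le_right.trans (div_nonneg (Real.log_nonneg ?_) (Nat.cast_nonneg n))
        rw [← h0, partitionSum_zero]
        exact_mod_cast (SAW.Zd.one_le_count 2 n : 1 ≤ SAW.count n)
      · refine inf_le_left.trans ?_
        rw [le_div_iff₀ (by exact_mod_cast hn), mul_comm, ← Real.log_pow]
        exact Real.log_le_log (pow_pos (by linarith) n) (pow_mul_le_partitionSum ht n)
  have hlim := hu.tendsto_lim hbdd
  have key : ∀ n : ℕ, (partitionSum t n) ^ (1 / (n : ℝ)) =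
      Real.exp (Real.log (partitionSum t n) / n) :=
    fun n => by rw [Real.rpow_def_of_pos (hpos n), mul_one_div]
  have hexp : Tendsto (fun n : ℕ => Real.exp (Real.log (partitionSum t n) / n)) atTop
      (𝓝 (Real.exp hu.lim)) :=
    (Real.continuous_exp.tendsto _).comp hlim
  have heq : (fun n : ℕ => (partitionSum t n) ^ (1 / (n : ℝ))) =
      fun n => Real.exp (Real.log (partitionSum t n) / n) := funext key
  rw [heq]
  convert hexp using 2
  apply le_antisymm
  · refine ge_of_tendsto hexp ?_
    filter_upwards [eventually_ge_atTop 1] with n hn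
    rw [← key n]
    exact connectiveConstant_le_rpow ht.1 (by omega)
  · refine le_ciInf fun n => ?_
    have h1 := hu.lim_le_div hbdd (Nat.succ_ne_zero n)
    have h2 := Real.exp_le_exp.2 h1
    rw [← key (n + 1)] at h2
    simpa [Nat.cast_succ] using h2

end Literature.Probability.RandomPlanarGeometry.BlobTime

end
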